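import Summits.CriticalPhenomena.SAWScalingLimit.Theses.SAWReversalUpgrade
import Literature.Barriers.CriticalPhenomena.SupercriticalSAWSpaceFillingReversible
import HarnessLib

/-!
# `NoDeepReturn`, line `naked-root-localisation` (SketchIdeator2): stub `stub_lawReverseEvent`
(item stmt-CriticalPhenomena-18004, route SAWReversalUpgrade; stub 2 of 5)

The law of a reversed two-vertex event. For predicates `P Q` on lattice sites, the critical SAW
law from `u` to `v` in `Ω_δ` of the event "`P` holds at some vertex `γ_i` and `Q` at a LATER
vertex `γ_j`, `i < j ≤ |γ|`" equals the critical SAW law from `v` to `u` of the event "`Q` at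
some vertex, `P` at a later vertex".

Proof. The critical law `SAW.law` is the fugacity-`x` law `SupercriticalSAW.lawAt x` at `x = x_c`
(`lawAt_criticalFugacity`, definitional), and the fugacity-`x` ensembles are EXACTLY reversible
(`SupercriticalSAW.lawAt_map_sawReverse`: `reverse_* P_{(Ω_δ,u,v,x)} = P_{(Ω_δ,v,u,x)}`, barrier
file `SupercriticalSAWSpaceFillingReversible`). Hence
`law(v → u)(T) = law(u → v)(reverse ⁻¹' T)` (`Measure.map_apply`; the σ-algebra on SAWs is
discrete), and it remains to identify the preimage of the "`Q` then `P`" event under reversal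
with the "`P` then `Q`" event (`lawReverseEvent_preimage`): the reversed walk satisfies
`γ^R_i = γ_{|γ| - i}` (`SimpleGraph.Walk.getVert_reverse`, `length_reverse`), so the index flip
`(i, j) ↦ (|γ| - j, |γ| - i)` exchanges "earlier" and "later" (`lawReverseEvent_indexFlip`, used
once for `γ` and once for `γ^R`, `sawReverse_sawReverse`). [cite: LawlerSchrammWerner2004SAW, §3.1]

Not here: the other four stubs of the line (polyline ⇒ vertex, first-entrance far bound, the atom
`RootLocalisation`, the residual `CollarReturnAvoidance`) and the glue.
-/

noncomputable section

namespace Summit.CriticalPhenomena.SAWScalingLimit.Theorems.NoDeepReturn.NakedRoot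

open MeasureTheory Filter Topology Set Metric
open scoped ENNReal
open Literature.Probability.LatticeModels (Site meshPoint discreteDomainGraph)
open Literature.Probability.RandomPlanarGeometry
open Literature.Probability.RandomPlanarGeometry.SAW
open Literature.Barriers.CriticalPhenomena.SupercriticalSAW

/-- **Index flip under walk reversal.** For a walk `p` of a simple graph and vertex predicates
`P Q`: if the reversed walk `p.reverse` has `Q` at a vertex `i` and `P` at a later vertex `j`
(`i < j ≤ |p|`), then `p` has `P` at the vertex `|p| - j` and `Q` at the later vertex `|p| - i`
(`p.reverse.getVert i = p.getVert (|p| - i)`, Mathlib `SimpleGraph.Walk.getVert_reverse`).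
Elementary (ℕ-subtraction bookkeeping by `omega`). -/
theorem lawReverseEvent_indexFlip {V : Type*} {G : SimpleGraph V} {u v : V} (P Q : V → Prop)
    (p : G.Walk u v)
    (h : ∃ i j : ℕ, i < j ∧ j ≤ p.reverse.length ∧ Q (p.reverse.getVert i) ∧
      P (p.reverse.getVert j)) :
    ∃ i j : ℕ, i < j ∧ j ≤ p.length ∧ P (p.getVert i) ∧ Q (p.getVert j) := by
  obtain ⟨i, j, hij, hj, hQ, hP⟩ := h
  rw [SimpleGraph.Walk.length_reverse] at hj
  rw [SimpleGraph.Walk.getVert_reverse] at hQ hP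
  exact ⟨p.length - j, p.length - i, by omega, Nat.sub_le _ _, hP, hQ⟩

/-- **The preimage of a two-vertex event under SAW reversal.** For SAWs of `Ω_δ` from `u` to `v`
and site predicates `P Q`, the preimage under `sawReverse : SAW(Ω_δ; u, v) → SAW(Ω_δ; v, u)` of
the event "`Q` at a vertex, `P` at a later vertex" is the event "`P` at a vertex, `Q` at a later
vertex" (the index flip `lawReverseEvent_indexFlip` applied to `γ` and to `γ^R`, reversal being
an involution, `sawReverse_sawReverse`). -/
theorem lawReverseEvent_preimage (Ω : Set ℂ) (δ : ℝ) (u v : Site 2) (P Q : Site 2 → Prop) :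
    sawReverse ⁻¹' {γ : DomainSAW Ω δ v u | ∃ i j : ℕ, i < j ∧ j ≤ γ.walk.length ∧
        Q (γ.walk.getVert i) ∧ P (γ.walk.getVert j)} =
      {γ : DomainSAW Ω δ u v | ∃ i j : ℕ, i < j ∧ j ≤ γ.walk.length ∧ P (γ.walk.getVert i) ∧
        Q (γ.walk.getVert j)} := by
  ext γ
  simp only [mem_preimage, mem_setOf_eq, walk_sawReverse]
  refine ⟨lawReverseEvent_indexFlip P Q γ.walk, fun h => ?_⟩
  refine lawReverseEvent_indexFlip Q P γ.walk.reverse ?_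
  rw [SimpleGraph.Walk.reverse_reverse]
  exact h

/-- **Stub 2 (law of a reversed two-vertex event)** of the line `naked-root-localisation` for
the crux `NoDeepReturn` (item stmt-CriticalPhenomena-18004). For every discrete domain `Ω_δ`,
endpoints `u v` and site predicates `P Q`: the critical SAW law from `u` to `v` of "`P` at a
vertex `γ_i`, `Q` at a LATER vertex `γ_j` (`i < j ≤ |γ|`)" equals the critical SAW law from `v`
to `u` of "`Q` at a vertex, `P` at a later vertex". Exact time reversal of the critical law
(`SupercriticalSAW.lawAt_map_sawReverse` at `x = x_c`, `lawAt_criticalFugacity`) and the index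
flip `i ↦ |γ| - i` (`lawReverseEvent_preimage`). [cite: LawlerSchrammWerner2004SAW, §3.1] -/
theorem stub_lawReverseEvent :
    ∀ (Ω : Set ℂ) (δ : ℝ) (u v : Site 2) (P Q : Site 2 → Prop),
      law Ω δ u v {γ | ∃ i j : ℕ, i < j ∧ j ≤ γ.walk.length ∧ P (γ.walk.getVert i) ∧
        Q (γ.walk.getVert j)} =
      law Ω δ v u {γ | ∃ i j : ℕ, i < j ∧ j ≤ γ.walk.length ∧ Q (γ.walk.getVert i) ∧
        P (γ.walk.getVert j)} := by
  intro Ω δ u v P Q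
  have h := lawAt_map_sawReverse criticalFugacity Ω δ u v
  rw [lawAt_criticalFugacity, lawAt_criticalFugacity] at h
  rw [← h, Measure.map_apply (DomainSAW.measurable_of_top _) MeasurableSpace.measurableSet_top,
    lawReverseEvent_preimage]

end Summit.CriticalPhenomena.SAWScalingLimit.Theorems.NoDeepReturn.NakedRoot

end
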